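import Summits.CriticalPhenomena.SAWScalingLimit.Theorems.SAWTwistedSelfEnergyParaMartingaleDefs
import Literature.Probability.RandomPlanarGeometry.ExteriorULC
import Literature.Probability.LatticeModels.MeshDomainBulk
import HarnessLib

/-!
# Crux `SubseqIdentification` (stmt-CriticalPhenomena-0783), line `parafermionic-martingale`:
# S5 `stub_existsRootedApprox` — every Dobrushin domain has a lattice-rooted endpoint approximation

For a Dobrushin domain `D = (Ω; a, b)` (bounded Jordan domain, two marked boundary points `a = D.pt 0`,
`b = D.pt 1`) with SOME endpoint approximation `(a_δ, b_δ)` (`SAW.IsEndpointApprox`: for small `δ > 0` the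
two lattice points are joined in the discrete domain `Ω_δ = discreteDomainGraph Ω δ`, and `δ a_δ → a`,
`δ b_δ → b`), we build a LATTICE-ROOTED one (`ParaMartingale.IsLatticeRooted`, registered stub
`stub_existsRootedApprox` of the checked skeleton of the line): the same target `b_δ`, and a new source
`a¹_δ` with a `ℤ²`-neighbour `a¹'_δ` such that `a¹_δ a¹'_δ` is NOT an edge of `Ω_δ`, still joined to `b_δ`
in `Ω_δ` and still converging to `a`.

Proof (lattice topology only; no regularity of the Jordan curve is used beyond the Jordan curve
theorem's corollary `JordanDomain.frontier_subset_closure_exterior'`, proved in the tree).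
Fix `δ > 0` and call a lattice point ROOTED if it is joined to `b_δ` in `Ω_δ` and has a `ℤ²`-neighbour
not joined to it by an edge of `Ω_δ`.
* The component of `b_δ` is finite (a vertex `x ≠ b_δ` joined to `b_δ` carries an edge of `Ω_δ`, hence
  lies in the finite set `meshDomain Ω δ`), and its vertex of maximal abscissa is rooted; so a rooted vertex
  `a¹_δ` minimising `dist (δ x, a)` exists (`exists_rooted_min`), with a witness neighbour `a¹'_δ`.
* `δ a¹_δ → a`: given `ε > 0`, pick an EXTERIOR point `u ∉ Ω̄` with `|u - a| < ε/4` (the JCT corollary)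
  and an exterior ball `B(u, ρ)`. For `δ < min ρ (ε/4)` with `|δ a_δ - a| < ε/4` and `a_δ ↔ b_δ` joined,
  the lattice point `e = [u/δ]` has `δ e ∉ Ω̄`, so NO edge of `Ω_δ` at `e`. If no rooted vertex were
  within `ε` of `a`, then "joined to `b_δ`" would propagate along every `ℤ²`-edge from any vertex of the
  lattice box spanned by `a_δ` and `e` (all within `ε` of `a`: `rectangle_subset_ball`), so by a monotone
  staircase (`box_induction`) `e` would be joined to `b_δ` — and then `e` itself is rooted and within
  `ε/2` of `a`, a contradiction. Hence the minimiser is within `ε` of `a` (`eventually_exists_rooted_near`).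
Sources: folklore lattice bookkeeping of discrete Dobrushin domains (S. Smirnov, C. R. Acad. Sci. 333
(2001) §2; D. Chelkak, S. Smirnov, Invent. Math. 189 (2012) §1.2); the root convention of
H. Duminil-Copin, S. Smirnov, Ann. of Math. 175 (2012) §4. Pattern in tree: the staircase lemma
`meshVertexGraph_reachable_of_rectangle_subset` (`Literature/…/MeshDomainBulk.lean`).
What is NOT here: the other statements S1–S4 of the line.
-/

noncomputable section

open MeasureTheory Filter Topology Set
open scoped NNReal ENNReal Classical BigOperators
open Literature.Probability.LatticeModels
open Literature.Probability.RandomPlanarGeometry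

namespace Summit.CriticalPhenomena.SAWScalingLimit.Theorems.SubseqIdentification.ParaMartingale

/-! ## Lattice bookkeeping: box connectivity of `ℤ²`, the component of `b_δ`, rooted vertices -/

/-- **Box induction (monotone staircase in `ℤ²`).** If a property `P` of lattice points holds at `a` and
passes from every point of the lattice box spanned by `a` and `b` satisfying `P` to each of its four
`ℤ²`-neighbours, then `P b` (move one coordinate of `a` one step towards `b`; the box shrinks).
[folklore] -/
-- adapted from `Literature.Probability.LatticeModels.meshVertexGraph_reachable_of_rectangle_subset`
-- (`Literature/Probability/LatticeModels/MeshDomainBulk.lean`): same coordinate bookkeeping, abstract `P`.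
theorem box_induction {P : Site 2 → Prop} :
    ∀ (n : ℕ) (a b : Site 2), (b 0 - a 0).natAbs + (b 1 - a 1).natAbs = n → P a →
      (∀ x : Site 2, (∀ j, x j ∈ uIcc (a j) (b j)) → P x →
        ∀ (i : Fin 2) (s : ℤ), s = 1 ∨ s = -1 → P (x + Pi.single i s)) →
      P b := by
  intro n
  induction n with
  | zero =>
    intro a b hn hPa _
    have hab : a = b := by
      ext j; fin_cases j <;> simp only [Fin.zero_eta, Fin.isValue, Fin.mk_one] <;> omega
    subst hab
    exact hPa
  | succ n ih =>
    intro a b hn hPa hstep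
    -- choose a coordinate `i` in which `a` and `b` differ, and the sign `s` pointing to `b`
    obtain ⟨i, hi⟩ : ∃ i : Fin 2, a i ≠ b i := by
      by_contra! h
      have h0 := h 0; have h1 := h 1
      omega
    set s : ℤ := if a i < b i then 1 else -1 with hs_def
    have hs : s = 1 ∨ s = -1 := by rw [hs_def]; split_ifs <;> simp
    set a' : Site 2 := a + Pi.single i s with ha'_def
    have ha'j : ∀ j, a' j = a j + if j = i then s else 0 := fun j => by
      rw [ha'_def, Pi.add_apply, Pi.single_apply]
    -- `a'` lies coordinatewise between `a` and `b`
    have hbetween : ∀ j, a' j ∈ uIcc (a j) (b j) := by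
      intro j
      rw [ha'j j, mem_uIcc]
      by_cases hji : j = i
      · subst hji
        rw [if_pos rfl, hs_def]
        split_ifs with hlt
        · left; constructor <;> omega
        · right; constructor <;> omega
      · rw [if_neg hji, add_zero]
        rcases le_total (a j) (b j) with h | h
        · exact Or.inl ⟨le_rfl, h⟩
        · exact Or.inr ⟨h, le_rfl⟩
    -- the lattice distance to `b` has dropped by one
    have hsgn : (a i < b i ∧ s = 1) ∨ (b i < a i ∧ s = -1) := by
      rw [hs_def]
      split_ifs with h
      · exact Or.inl ⟨h, rfl⟩
      · exact Or.inr ⟨lt_of_le_of_ne (not_lt.1 h) (Ne.symm hi), rfl⟩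
    have hn' : (b 0 - a' 0).natAbs + (b 1 - a' 1).natAbs = n := by
      have h0 := ha'j 0
      have h1 := ha'j 1
      fin_cases i
      · simp only [Fin.zero_eta, Fin.isValue, ↓reduceIte, one_ne_zero] at h0 h1 hsgn
        rw [h0, h1]
        omega
      · simp only [Fin.mk_one, Fin.isValue, zero_ne_one, ↓reduceIte] at h0 h1 hsgn
        rw [h0, h1]
        omega
    -- one step `a → a'`, then the induction hypothesis in the smaller box
    have hPa' : P a' := hstep a (fun j => left_mem_uIcc) hPa i s hs
    exact ih a' b hn' hPa' fun x hx hPx k t ht =>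
      hstep x (fun j => uIcc_subset_uIcc (hbetween j) right_mem_uIcc (hx j)) hPx k t ht

/-- For a bounded domain and `δ > 0` the component of a lattice point `b` in `Ω_δ` is finite: it lies in
`{b} ∪ meshDomain Ω δ`, since the first edge of a walk joining `x ≠ b` to `b` is an edge of `Ω_δ` (cf.
`IsingBoundaryRatio.Negative.mem_meshDomain_of_reachable_ne`). [folklore] -/
theorem finite_reachable {Ω : Set ℂ} (hΩ : Bornology.IsBounded Ω) {δ : ℝ} (hδ : 0 < δ) (b : Site 2) :
    {x : Site 2 | (discreteDomainGraph Ω δ).Reachable x b}.Finite :=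
  ((meshDomain_finite hΩ hδ).insert b).subset
    fun x (hx : (discreteDomainGraph Ω δ).Reachable x b) => by
      obtain ⟨p⟩ := hx
      cases p with
      | nil => exact mem_insert _ _
      | cons hadj _ => exact mem_insert_of_mem _ (discreteDomainGraph_adj_iff.1 hadj).2.1

/-- **Rooted vertices exist.** For a bounded domain and `δ > 0`, the component of `b` in `Ω_δ` contains a
vertex with a `ℤ²`-neighbour NOT joined to it by an edge of `Ω_δ`: its vertex of maximal abscissa and the
eastern neighbour of that vertex. [folklore] -/
theorem exists_rooted {Ω : Set ℂ} (hΩ : Bornology.IsBounded Ω) {δ : ℝ} (hδ : 0 < δ) (b : Site 2) :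
    ∃ x y : Site 2, (discreteDomainGraph Ω δ).Reachable x b ∧ (zdGraph 2).Adj x y ∧
      ¬ (discreteDomainGraph Ω δ).Adj x y := by
  obtain ⟨x, hx, hmax⟩ := Set.exists_max_image _ (fun x : Site 2 => x 0)
    (finite_reachable hΩ hδ b) ⟨b, SimpleGraph.Reachable.refl b⟩
  refine ⟨x, x + Pi.single 0 1, hx, zdGraph_adj_add_single x 0 (Or.inl rfl), fun hadj => ?_⟩
  have h := hmax _ (hadj.symm.reachable.trans hx)
  rw [Pi.add_apply, Pi.single_eq_same] at h
  omega

/-- **A rooted vertex closest to a given point.** For a bounded domain, `δ > 0`, a lattice point `b` and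
`p ∈ ℂ`, some vertex `x` of the component of `b` in `Ω_δ` with a `ℤ²`-neighbour `y` not joined to it in
`Ω_δ` minimises `dist (δ x) p` among all such vertices (finite argmin). [folklore] -/
theorem exists_rooted_min {Ω : Set ℂ} (hΩ : Bornology.IsBounded Ω) {δ : ℝ} (hδ : 0 < δ) (b : Site 2)
    (p : ℂ) :
    ∃ x y : Site 2, (discreteDomainGraph Ω δ).Reachable x b ∧ (zdGraph 2).Adj x y ∧
      ¬ (discreteDomainGraph Ω δ).Adj x y ∧
      ∀ x' y' : Site 2, (discreteDomainGraph Ω δ).Reachable x' b → (zdGraph 2).Adj x' y' →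
        ¬ (discreteDomainGraph Ω δ).Adj x' y' → dist (meshPoint δ x) p ≤ dist (meshPoint δ x') p := by
  set F : Set (Site 2) := {x | (discreteDomainGraph Ω δ).Reachable x b ∧
    ∃ y, (zdGraph 2).Adj x y ∧ ¬ (discreteDomainGraph Ω δ).Adj x y} with hF_def
  have hF : F.Finite := (finite_reachable hΩ hδ b).subset fun x hx => hx.1
  obtain ⟨x₀, y₀, h1, h2, h3⟩ := exists_rooted hΩ hδ b
  obtain ⟨x, ⟨hx, y, hy, hxy⟩, hmin⟩ :=
    Set.exists_min_image F (fun x => dist (meshPoint δ x) p) hF ⟨x₀, h1, y₀, h2, h3⟩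
  exact ⟨x, y, hx, hy, hxy, fun x' y' h1' h2' h3' => hmin x' ⟨h1', y', h2', h3'⟩⟩

/-! ## Rooted vertices near the marked point `a` -/

/-- **Rooted vertices accumulate at the marked point.** For an endpoint approximation `(a_δ, b_δ)` of the
Dobrushin domain `D` and `ε > 0`, for all small `δ > 0` some vertex of the component of `b_δ` in `Ω_δ`
with a `ℤ²`-neighbour not joined to it in `Ω_δ` lies within `ε` of `a = D.pt 0` (exterior point near `a`
by the Jordan curve theorem, then box connectivity of `ℤ²` from `a_δ`; see the module docstring).
[folklore] -/
theorem eventually_exists_rooted_near (D : DobrushinDomain) {a b : ℝ → Site 2}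
    (hab : SAW.IsEndpointApprox D a b) {ε : ℝ} (hε : 0 < ε) :
    ∀ᶠ δ in 𝓝[>] (0 : ℝ), ∃ x y : Site 2, (discreteDomainGraph D.carrier δ).Reachable x (b δ) ∧
      (zdGraph 2).Adj x y ∧ ¬ (discreteDomainGraph D.carrier δ).Adj x y ∧
      dist (meshPoint δ x) (D.pt 0) < ε := by
  -- an exterior point `u` near `a = D.pt 0` (JCT corollary) and an exterior ball about it
  have hp : D.pt 0 ∈ closure (closure D.carrier)ᶜ :=
    D.frontier_subset_closure_exterior' (D.pt_mem_frontier 0)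
  obtain ⟨u, hu, hpu⟩ := Metric.mem_closure_iff.1 hp (ε / 4) (by positivity)
  obtain ⟨ρ, hρ, hball⟩ := Metric.isOpen_iff.1 isClosed_closure.isOpen_compl u hu
  have h1 : ∀ᶠ δ in 𝓝[>] (0 : ℝ), 0 < δ := eventually_mem_nhdsWithin
  have h2 : ∀ᶠ δ in 𝓝[>] (0 : ℝ), δ < min ρ (ε / 4) :=
    (eventually_lt_nhds (by positivity)).filter_mono nhdsWithin_le_nhds
  have h3 : ∀ᶠ δ in 𝓝[>] (0 : ℝ), dist (meshPoint δ (a δ)) (D.pt 0) < ε / 4 :=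
    Metric.tendsto_nhds.1 hab.tendsto_fst _ (by positivity)
  filter_upwards [h1, h2, h3, hab.reachable] with δ hδ hδlt haδ hreach
  obtain ⟨hδρ, hδε⟩ := lt_min_iff.1 hδlt
  set G := discreteDomainGraph D.carrier δ with hG_def
  -- the lattice point nearest to `u`: exterior, hence without edges of `Ω_δ`, and within `ε/2` of `a`
  set e : Site 2 := nearestSite δ u with he_def
  have heu : dist (meshPoint δ e) u ≤ δ := dist_meshPoint_nearestSite_le hδ u
  have heext : meshPoint δ e ∉ closure D.carrier := hball (Metric.mem_ball.2 (heu.trans_lt hδρ))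
  have hep : dist (meshPoint δ e) (D.pt 0) < ε / 2 :=
    calc dist (meshPoint δ e) (D.pt 0) ≤ dist (meshPoint δ e) u + dist u (D.pt 0) := dist_triangle _ _ _
      _ < δ + ε / 4 := add_lt_add_of_le_of_lt heu (by rwa [dist_comm])
      _ < ε / 2 := by linarith
  have he_noadj : ∀ y, ¬ G.Adj e y := fun y hadj =>
    heext (subset_closure
      (meshDomain_subset_meshVertices _ _ (discreteDomainGraph_adj_iff.1 hadj).2.1))
  by_contra H
  push Not at H
  -- every vertex of the lattice box spanned by `a δ` and `e` is within `ε` of `a`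
  have hbox : ∀ x : Site 2, (∀ j, x j ∈ uIcc (a δ j) (e j)) → dist (meshPoint δ x) (D.pt 0) < ε := by
    intro x hx
    have h := rectangle_subset_ball (haδ.trans (by linarith)) hep (meshPoint_mem_rectangle hδ.le hx)
    rw [Metric.mem_ball] at h
    linarith
  -- so "joined to `b δ`" propagates along `ℤ²`-edges inside the box, from `a δ` up to `e`
  have hPe : G.Reachable e (b δ) := by
    refine box_induction (P := fun x => G.Reachable x (b δ)) _ (a δ) e rfl hreach ?_
    intro x hx hPx i s hs
    by_cases hG : G.Adj x (x + Pi.single i s)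
    · exact hG.symm.reachable.trans hPx
    · exact absurd (hbox x hx) (not_lt.2 (H x _ hPx (zdGraph_adj_add_single x i hs) hG))
  -- but then `e` is rooted and close to `a`
  have h := H e (e + Pi.single 0 1) hPe (zdGraph_adj_add_single e 0 (Or.inl rfl)) (he_noadj _)
  linarith

/-! ## S5 -/

/-- **S5 `stub_existsRootedApprox` (lattice-rooted form, lead reshape r-c6-1).** Every Dobrushin domain
with an endpoint approximation `(a_δ, b_δ)` has a LATTICE-ROOTED one: keep `b_δ`, and take for the new
source a vertex of the component of `b_δ` in `Ω_δ` having a `ℤ²`-neighbour not joined to it in `Ω_δ` and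
closest to `a` (its witness neighbour is the root); it converges to `a` by
`eventually_exists_rooted_near`. [folklore] -/
theorem stub_existsRootedApprox : ∀ (D : DobrushinDomain) (a b : ℝ → Site 2),
    SAW.IsEndpointApprox D a b → ∃ a₁ a₁' b₁ : ℝ → Site 2, IsLatticeRooted D a₁ a₁' b₁ := by
  intro D a b hab
  have key : ∀ δ : ℝ, 0 < δ → ∃ x y : Site 2,
      (discreteDomainGraph D.carrier δ).Reachable x (b δ) ∧ (zdGraph 2).Adj x y ∧
        ¬ (discreteDomainGraph D.carrier δ).Adj x y ∧
        ∀ x' y' : Site 2, (discreteDomainGraph D.carrier δ).Reachable x' (b δ) →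
          (zdGraph 2).Adj x' y' → ¬ (discreteDomainGraph D.carrier δ).Adj x' y' →
          dist (meshPoint δ x) (D.pt 0) ≤ dist (meshPoint δ x') (D.pt 0) :=
    fun δ hδ => exists_rooted_min D.isBounded hδ (b δ) (D.pt 0)
  choose! a₁ a₁' hreach hadj hnadj hmin using key
  have h0 : ∀ᶠ δ in 𝓝[>] (0 : ℝ), 0 < δ := eventually_mem_nhdsWithin
  refine ⟨a₁, a₁', b, ⟨h0.mono fun δ hδ => hreach δ hδ, ?_, hab.tendsto_snd⟩,
    h0.mono fun δ hδ => ⟨hadj δ hδ, hnadj δ hδ⟩⟩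
  rw [Metric.tendsto_nhds]
  intro ε hε
  filter_upwards [h0, eventually_exists_rooted_near D hab hε] with δ hδ ⟨x, y, hx, hy, hxy, hdist⟩
  exact (hmin δ hδ x y hx hy hxy).trans_lt hdist

end Summit.CriticalPhenomena.SAWScalingLimit.Theorems.SubseqIdentification.ParaMartingale

end
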